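import Literature.AlgebraicGeometry.Resolution.CoordinateBlowupChart
import Summits.ResolutionOfSingularities.ResolutionOfSingularities.Theorems.EquisingularLiftEquisingularLiftNatSpecimenWhitneyCubicAlgebra
import Literature.AlgebraicGeometry.Resolution.BlowupAlgebraStrictTransform
import Literature.AlgebraicGeometry.Resolution.RegularDerivationQuotient
import Literature.AlgebraicGeometry.Resolution.RegularHomReduced
import Mathlib.RingTheory.RegularLocalRing.Polynomial
import Mathlib.Algebra.MvPolynomial.PDeriv
import Mathlib.Algebra.MvPolynomial.Division
import Mathlib.RingTheory.Polynomial.UniqueFactorization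
import HarnessLib

/-!
# [OURS · L1 W4.5(b) · EL♮(3)] NOSE ENGINE CERTIFICATION ‖ K, specimen 2 — the CUSPIDAL CUBIC CONE `x₀x₂² = x₃³`: chart algebra of the blow-up
# along its double line (every field, every characteristic)

Cell `res-hironaka`, slot W4.5(b); crux **EL♮(3)** (stmt-ResolutionOfSingularities-20148); width seat res-L1-w45b-nose-w3, row «NOSE ENGINE CERT ‖ K» of
res-L1-w45b-plan-1's WIDTH TABLE D1′. `--supports stmt-ResolutionOfSingularities-20148 --as helper`; closes nothing. OURS; NOT a statement of any
manuscript; AI-written, weaker than expert review. No `sorry`, standard axioms; six small `def`s (chart equations) for readability.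
Pattern: res-D-pv-022's `…NatSpecimenWhitneyCubicAlgebra` (R2), with ONE change of method — the strict-transform charts are read through the tree's
COORDINATE BLOW-UP CHART ISOMORPHISM `k[y][I/y_{i₀}] ≅ k[y]` (`Literature.….coordBlowupChartEquiv`, Hu 2025 Prop. 5.3 / Görtz–Wedhorn (13.19)) instead of
plain extensions of `∂/∂y₀` (which do not certify the cusp charts: `y₀` is absent from `y₁² − y₂³`).

The specimen: `H = V₊(x₀x₂² − x₃³) ⊂ ℙ³_k`, the cone (vertex `[0:1:0:0]`) over the cuspidal plane cubic; singular along the DOUBLE LINE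
`Σ = V(x₂, x₃)` with transversal type `A₂` (cusp) at `x₀ ≠ 0` and a point of multiplicity `3` at the vertex. On the charts `D₊(x_c)` with
coordinates `y = (y₀, y₁, y₂)` (the other variables in order) the equations are

  `g₁ = y₀y₁² − y₂³` (`c = 1`), `g₀ = y₁² − y₂³` (`c = 0`), centre `I = (y₁, y₂)`;   `g₂ = y₀ − y₂³` (`c = 2`), `g₃ = y₀y₂² − 1` (`c = 3`), centre `(1)`.

* `isRegularRing_strictTransformChart` — GENERIC: for `f ∈ k[y₀,y₁,y₂]` and a centre variable `y_{i₀}` (`i₀ ∈ {1,2}`), if Hu's substitution gives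
  `f(y₀, …, y_{i₀}y_i, …) = y_{i₀}ⁿ · f′` with `y_{i₀} ∤ f′` and `k[y]/(f′)` regular, then the strict-transform chart ring `(k[y]/(f))[Ī/ȳ_{i₀}]`
  is a regular ring (`coordBlowupChartEquiv` + Görtz–Wedhorn Prop. 13.96 (2) `blowupAlgebra.quotientKerMapQuotientEquiv`);
* the four strict-transform charts: `g₁`: `y₀ − y₁y₂³` (`∂₀ = 1`), `y₀y₁² − y₂` (`∂₂ = −1`); `g₀`: `1 − y₁y₂³` (`∂₁ = −y₂³`, a unit), `y₁² − y₂`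
  (`∂₂ = −1`) — `isRegularRing_chart₁₁/₁₂/₀₁/₀₂`; the two smooth charts `isRegularRing_quotient_g₂/g₃` and their radical ideals;
* `prime_g₁` (degree one in `y₀`, coprime coefficients), `prime_g₀` (`Y² − y₂³` has no root in `k[y₀, y₂]` by degrees), `radical_span_g₀/g₁`.

References: U. Görtz, T. Wedhorn, *Algebraic Geometry I* (2020), (13.19), Prop. 13.96; Y. Hu, arXiv:2507.21400 §5 Prop. 5.3; The Stacks Project 07PF,
0804 — through the cited tree files.
-/

set_option linter.dupNamespace false -- mandated namespace `Summit.<Summit>.<Problem>` of this single-conjunct summit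

noncomputable section

open MvPolynomial
open Literature.AlgebraicGeometry.Resolution

namespace Summit.ResolutionOfSingularities.ResolutionOfSingularities.Cruxes.EquisingularLiftNat.Sections

namespace CuspCone

variable (k : Type) [Field k]

/-! ## The centre `I = (y₁, y₂)` and the generic strict-transform chart -/

/-- The centre variables `{1, 2}` of the chart ring `k[y₀, y₁, y₂]` (the double line `Σ ∩ D₊(x_c)`, `c = 0, 1`). [folklore] -/
abbrev cenVars : Set (Fin 3) := {1, 2}

/-- **GENERIC STRICT-TRANSFORM CHART through the coordinate blow-up chart isomorphism.** Let `f ∈ k[y₀,y₁,y₂]`, `I = (y₁, y₂)`, `i₀ ∈ {1,2}`,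
and suppose Hu's substitution (`y_i ↦ y_{i₀}y_i` for the other centre variable) gives `f ↦ y_{i₀}ⁿ · f′` with `y_{i₀} ∤ f′` and `k[y]/(f′)` regular.
Under `k[y] ≅ k[y][I/y_{i₀}]` (`coordBlowupChartEquiv`; the structure map becomes the substitution) this says `f = y_{i₀}ⁿ·f′` in the chart ring with
`y_{i₀}` prime and `y_{i₀} ∤ f′`, so `(k[y]/(f))[Ī/ȳ_{i₀}] ≅ k[y][I/y_{i₀}]/(f′) ≅ k[y]/(f′)` (Görtz–Wedhorn Prop. 13.96 (2)) is regular.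
[cite: GortzWedhorn2020, Prop. 13.96 (2)] [cite: Hu2025, §5 Prop. 5.3] -/
theorem isRegularRing_strictTransformChart (f f' : MvPolynomial (Fin 3) k) (i₀ : Fin 3) (n : ℕ)
    (hsubst : coordBlowupSubst k cenVars i₀ f = X i₀ ^ n * f')
    (hndvd : ¬ ((X i₀ : MvPolynomial (Fin 3) k) ∣ f'))
    (hreg : IsRegularRing (MvPolynomial (Fin 3) k ⧸ Ideal.span {f'})) :
    IsRegularRing (blowupAlgebra ((Ideal.span (X '' cenVars)).map (Ideal.Quotient.mk (Ideal.span {f})))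
      (Ideal.Quotient.mk (Ideal.span {f}) (X i₀ : MvPolynomial (Fin 3) k))) := by
  set e := coordBlowupChartEquiv k cenVars i₀ with he
  have halg : ∀ p : MvPolynomial (Fin 3) k,
      algebraMap (MvPolynomial (Fin 3) k) (blowupAlgebra (Ideal.span (X '' cenVars)) (X i₀ : MvPolynomial (Fin 3) k)) p =
        e (coordBlowupSubst k cenVars i₀ p) := fun p =>
    (coordBlowupChartEquiv_coordBlowupSubst k cenVars i₀ p).symm
  have hb : algebraMap (MvPolynomial (Fin 3) k) (blowupAlgebra (Ideal.span (X '' cenVars)) (X i₀ : MvPolynomial (Fin 3) k)) (X i₀) =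
      e (X i₀) := by
    rw [halg, coordBlowupSubst_X_self]
  have hf : algebraMap (MvPolynomial (Fin 3) k) (blowupAlgebra (Ideal.span (X '' cenVars)) (X i₀ : MvPolynomial (Fin 3) k)) f =
      algebraMap (MvPolynomial (Fin 3) k) (blowupAlgebra (Ideal.span (X '' cenVars)) (X i₀ : MvPolynomial (Fin 3) k)) (X i₀) ^ n *
        e f' := by
    rw [halg, hsubst, map_mul, map_pow, hb]
  have hprime : Prime (algebraMap (MvPolynomial (Fin 3) k)
      (blowupAlgebra (Ideal.span (X '' cenVars)) (X i₀ : MvPolynomial (Fin 3) k)) (X i₀)) := by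
    rw [hb]
    exact (MulEquiv.prime_iff e.toMulEquiv).mpr X_prime
  have hndvd' : ¬ (algebraMap (MvPolynomial (Fin 3) k)
      (blowupAlgebra (Ideal.span (X '' cenVars)) (X i₀ : MvPolynomial (Fin 3) k)) (X i₀) ∣ e f') := by
    rw [hb]
    intro h
    exact hndvd ((map_dvd_iff e.toMulEquiv).mp h)
  have hmap : Ideal.span {e f'} = (Ideal.span {f'}).map e.toRingEquiv.toRingHom := by
    rw [Ideal.map_span, Set.image_singleton]
    rfl
  haveI : IsRegularRing (blowupAlgebra (Ideal.span (X '' cenVars)) (X i₀ : MvPolynomial (Fin 3) k) ⧸ Ideal.span {e f'}) :=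
    IsRegularRing.of_ringEquiv (Ideal.quotientEquiv (Ideal.span {f'}) (Ideal.span {e f'}) e.toRingEquiv hmap)
  exact IsRegularRing.of_ringEquiv
    (R := blowupAlgebra (Ideal.span (X '' cenVars)) (X i₀ : MvPolynomial (Fin 3) k) ⧸ Ideal.span {e f'})
    (blowupAlgebra.quotientKerMapQuotientEquiv _ _ hf hprime hndvd')

/-! ## The chart equations -/

/-- `g₁ = y₀y₁² − y₂³`: the chart `D₊(x₁)` (`y = (x₀, x₂, x₃)`; contains the vertex `y = 0`). [folklore] -/
def g₁ : MvPolynomial (Fin 3) k := X 0 * X 1 ^ 2 - X 2 ^ 3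

/-- `g₀ = y₁² − y₂³`: the chart `D₊(x₀)` (`y = (x₁, x₂, x₃)`; the cylinder over the cuspidal cubic). [folklore] -/
def g₀ : MvPolynomial (Fin 3) k := X 1 ^ 2 - X 2 ^ 3

/-- `g₂ = y₀ − y₂³`: the chart `D₊(x₂)` (`y = (x₀, x₁, x₃)`), off the double line. [folklore] -/
def g₂ : MvPolynomial (Fin 3) k := X 0 - X 2 ^ 3

/-- `g₃ = y₀y₂² − 1`: the chart `D₊(x₃)` (`y = (x₀, x₁, x₂)`), off the double line. [folklore] -/
def g₃ : MvPolynomial (Fin 3) k := X 0 * X 2 ^ 2 - 1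

/-- The strict transform `y₀ − y₁y₂³` of `g₁` on the chart `b = y₁` (`y₂ ↦ y₁y₂`). [folklore] -/
def g₁' : MvPolynomial (Fin 3) k := X 0 - X 1 * X 2 ^ 3

/-- The strict transform `y₀y₁² − y₂` of `g₁` on the chart `b = y₂` (`y₁ ↦ y₂y₁`). [folklore] -/
def g₁'' : MvPolynomial (Fin 3) k := X 0 * X 1 ^ 2 - X 2

/-- The strict transform `1 − y₁y₂³` of `g₀` on the chart `b = y₁`. [folklore] -/
def g₀' : MvPolynomial (Fin 3) k := 1 - X 1 * X 2 ^ 3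

/-- The strict transform `y₁² − y₂` of `g₀` on the chart `b = y₂`. [folklore] -/
def g₀'' : MvPolynomial (Fin 3) k := X 1 ^ 2 - X 2

/-! ## The substitutions -/

/-- On the chart `b = y₁`: `y₀ ↦ y₀`, `y₁ ↦ y₁`, `y₂ ↦ y₁y₂`. [folklore] -/
theorem subst₁_X :
    coordBlowupSubst k cenVars 1 (X 0 : MvPolynomial (Fin 3) k) = X 0 ∧
      coordBlowupSubst k cenVars 1 (X 1 : MvPolynomial (Fin 3) k) = X 1 ∧
        coordBlowupSubst k cenVars 1 (X 2 : MvPolynomial (Fin 3) k) = X 1 * X 2 := by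
  refine ⟨coordBlowupSubst_X_of_not_mem k cenVars 1 (by decide), coordBlowupSubst_X_self k cenVars 1,
    coordBlowupSubst_X_of_mem_of_ne k cenVars 1 (by simp [cenVars]) (by decide)⟩

/-- On the chart `b = y₂`: `y₀ ↦ y₀`, `y₁ ↦ y₂y₁`, `y₂ ↦ y₂`. [folklore] -/
theorem subst₂_X :
    coordBlowupSubst k cenVars 2 (X 0 : MvPolynomial (Fin 3) k) = X 0 ∧
      coordBlowupSubst k cenVars 2 (X 1 : MvPolynomial (Fin 3) k) = X 2 * X 1 ∧
        coordBlowupSubst k cenVars 2 (X 2 : MvPolynomial (Fin 3) k) = X 2 := by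
  refine ⟨coordBlowupSubst_X_of_not_mem k cenVars 2 (by decide),
    coordBlowupSubst_X_of_mem_of_ne k cenVars 2 (by simp [cenVars]) (by decide), coordBlowupSubst_X_self k cenVars 2⟩

/-! ## The four strict-transform charts of the double line -/

/-- **Chart `c = 1`, `b = y₁`**: `g₁ ↦ y₁²·(y₀ − y₁y₂³)`, `∂₀(y₀ − y₁y₂³) = 1`; the chart ring `(k[y]/(g₁))[Ī/ȳ₁]` is regular. [folklore] -/
theorem isRegularRing_chart₁₁ :
    IsRegularRing (blowupAlgebra ((Ideal.span (X '' cenVars)).map (Ideal.Quotient.mk (Ideal.span {g₁ k})))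
      (Ideal.Quotient.mk (Ideal.span {g₁ k}) (X 1 : MvPolynomial (Fin 3) k))) := by
  obtain ⟨h0, h1, h2⟩ := subst₁_X k
  refine isRegularRing_strictTransformChart k (g₁ k) (g₁' k) 1 2 ?_ ?_ ?_
  · simp only [g₁, g₁', map_sub, map_mul, map_pow, h0, h1, h2]
    ring
  · rintro ⟨q, hq⟩
    have h := congrArg (MvPolynomial.eval ![(1 : k), 0, 0]) hq
    simp [g₁'] at h
  · refine isRegularRing_quotient_of_derivation (g₁' k) (pderiv 0 : Derivation k (MvPolynomial (Fin 3) k) (MvPolynomial (Fin 3) k)) ?_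
    have h : (pderiv 0 : Derivation k (MvPolynomial (Fin 3) k) (MvPolynomial (Fin 3) k)) (g₁' k) = 1 := by
      simp [g₁', pderiv_X, Derivation.leibniz_pow]
    rw [h, map_one]
    exact isUnit_one

/-- **Chart `c = 1`, `b = y₂`**: `g₁ ↦ y₂²·(y₀y₁² − y₂)`, `∂₂(y₀y₁² − y₂) = −1`; the chart ring `(k[y]/(g₁))[Ī/ȳ₂]` is regular. [folklore] -/
theorem isRegularRing_chart₁₂ :
    IsRegularRing (blowupAlgebra ((Ideal.span (X '' cenVars)).map (Ideal.Quotient.mk (Ideal.span {g₁ k})))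
      (Ideal.Quotient.mk (Ideal.span {g₁ k}) (X 2 : MvPolynomial (Fin 3) k))) := by
  obtain ⟨h0, h1, h2⟩ := subst₂_X k
  refine isRegularRing_strictTransformChart k (g₁ k) (g₁'' k) 2 2 ?_ ?_ ?_
  · simp only [g₁, g₁'', map_sub, map_mul, map_pow, h0, h1, h2]
    ring
  · rintro ⟨q, hq⟩
    have h := congrArg (MvPolynomial.eval ![(1 : k), 1, 0]) hq
    simp [g₁''] at h
  · refine isRegularRing_quotient_of_derivation (g₁'' k) (pderiv 2 : Derivation k (MvPolynomial (Fin 3) k) (MvPolynomial (Fin 3) k)) ?_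
    have h : (pderiv 2 : Derivation k (MvPolynomial (Fin 3) k) (MvPolynomial (Fin 3) k)) (g₁'' k) = -1 := by
      simp [g₁'', pderiv_X, Derivation.leibniz_pow]
    rw [h]
    exact ((isUnit_one (M := MvPolynomial (Fin 3) k)).neg).map (Ideal.Quotient.mk _)

/-- **Chart `c = 0`, `b = y₁`**: `g₀ ↦ y₁²·(1 − y₁y₂³)`, `∂₁(1 − y₁y₂³) = −y₂³`, a unit modulo `1 − y₁y₂³` (`(−y₂³)(−y₁) ≡ 1`); the chart ring
`(k[y]/(g₀))[Ī/ȳ₁]` is regular. [folklore] -/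
theorem isRegularRing_chart₀₁ :
    IsRegularRing (blowupAlgebra ((Ideal.span (X '' cenVars)).map (Ideal.Quotient.mk (Ideal.span {g₀ k})))
      (Ideal.Quotient.mk (Ideal.span {g₀ k}) (X 1 : MvPolynomial (Fin 3) k))) := by
  obtain ⟨h0, h1, h2⟩ := subst₁_X k
  refine isRegularRing_strictTransformChart k (g₀ k) (g₀' k) 1 2 ?_ ?_ ?_
  · simp only [g₀, g₀', map_sub, map_pow, h1, h2]
    ring
  · rintro ⟨q, hq⟩
    have h := congrArg (MvPolynomial.eval ![(0 : k), 0, 0]) hq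
    simp [g₀'] at h
  · refine isRegularRing_quotient_of_derivation (g₀' k) (pderiv 1 : Derivation k (MvPolynomial (Fin 3) k) (MvPolynomial (Fin 3) k)) ?_
    have h : (pderiv 1 : Derivation k (MvPolynomial (Fin 3) k) (MvPolynomial (Fin 3) k)) (g₀' k) = -(X 2 ^ 3) := by
      simp [g₀', pderiv_X, Derivation.leibniz_pow]
    rw [h]
    refine WhitneyCubic.isUnit_of_mul_eq_one' (Ideal.Quotient.mk _ (-(X 1))) ?_
    rw [← map_mul, ← (Ideal.Quotient.mk _).map_one, Ideal.Quotient.eq]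
    exact Ideal.mem_span_singleton.mpr ⟨-1, by rw [g₀']; ring⟩

/-- **Chart `c = 0`, `b = y₂`**: `g₀ ↦ y₂²·(y₁² − y₂)`, `∂₂(y₁² − y₂) = −1`; the chart ring `(k[y]/(g₀))[Ī/ȳ₂]` is regular. [folklore] -/
theorem isRegularRing_chart₀₂ :
    IsRegularRing (blowupAlgebra ((Ideal.span (X '' cenVars)).map (Ideal.Quotient.mk (Ideal.span {g₀ k})))
      (Ideal.Quotient.mk (Ideal.span {g₀ k}) (X 2 : MvPolynomial (Fin 3) k))) := by
  obtain ⟨h0, h1, h2⟩ := subst₂_X k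
  refine isRegularRing_strictTransformChart k (g₀ k) (g₀'' k) 2 2 ?_ ?_ ?_
  · simp only [g₀, g₀'', map_sub, map_pow, h1, h2]
    ring
  · rintro ⟨q, hq⟩
    have h := congrArg (MvPolynomial.eval ![(0 : k), 1, 0]) hq
    simp [g₀''] at h
  · refine isRegularRing_quotient_of_derivation (g₀'' k) (pderiv 2 : Derivation k (MvPolynomial (Fin 3) k) (MvPolynomial (Fin 3) k)) ?_
    have h : (pderiv 2 : Derivation k (MvPolynomial (Fin 3) k) (MvPolynomial (Fin 3) k)) (g₀'' k) = -1 := by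
      simp [g₀'', pderiv_X, Derivation.leibniz_pow]
    rw [h]
    exact ((isUnit_one (M := MvPolynomial (Fin 3) k)).neg).map (Ideal.Quotient.mk _)

/-! ## The two charts off the double line -/

/-- **Chart `c = 2`**: `k[y]/(g₂)`, `g₂ = y₀ − y₂³`, is a regular ring (`∂₀ g₂ = 1`). [folklore] -/
theorem isRegularRing_quotient_g₂ : IsRegularRing (MvPolynomial (Fin 3) k ⧸ Ideal.span {g₂ k}) := by
  refine isRegularRing_quotient_of_derivation (g₂ k)
    (pderiv 0 : Derivation k (MvPolynomial (Fin 3) k) (MvPolynomial (Fin 3) k)) ?_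
  have h : (pderiv 0 : Derivation k (MvPolynomial (Fin 3) k) (MvPolynomial (Fin 3) k)) (g₂ k) = 1 := by
    simp [g₂, pderiv_X, Derivation.leibniz_pow]
  rw [h, map_one]
  exact isUnit_one

/-- **Chart `c = 3`**: `k[y]/(g₃)`, `g₃ = y₀y₂² − 1`, is a regular ring (`∂₀ g₃ = y₂²`, a unit: `y₂²·y₀ ≡ 1`). [folklore] -/
theorem isRegularRing_quotient_g₃ : IsRegularRing (MvPolynomial (Fin 3) k ⧸ Ideal.span {g₃ k}) := by
  refine isRegularRing_quotient_of_derivation (g₃ k)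
    (pderiv 0 : Derivation k (MvPolynomial (Fin 3) k) (MvPolynomial (Fin 3) k)) ?_
  have h : (pderiv 0 : Derivation k (MvPolynomial (Fin 3) k) (MvPolynomial (Fin 3) k)) (g₃ k) = X 2 ^ 2 := by
    simp [g₃, pderiv_X, Derivation.leibniz_pow]
  rw [h]
  refine WhitneyCubic.isUnit_of_mul_eq_one' (Ideal.Quotient.mk _ (X 0)) ?_
  rw [← map_mul, ← (Ideal.Quotient.mk _).map_one, Ideal.Quotient.eq]
  exact Ideal.mem_span_singleton.mpr ⟨1, by rw [g₃]; ring⟩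

/-- `(g₂)` is a radical ideal (its quotient is regular, hence reduced). [folklore] -/
theorem radical_span_g₂ : (Ideal.span {g₂ k}).radical = Ideal.span {g₂ k} := by
  haveI := isRegularRing_quotient_g₂ k
  haveI := IsRegularRing.isReduced' (MvPolynomial (Fin 3) k ⧸ Ideal.span {g₂ k})
  exact (Ideal.isRadical_iff_quotient_reduced _).mpr inferInstance |>.radical

/-- `(g₃)` is a radical ideal. [folklore] -/
theorem radical_span_g₃ : (Ideal.span {g₃ k}).radical = Ideal.span {g₃ k} := by
  haveI := isRegularRing_quotient_g₃ k
  haveI := IsRegularRing.isReduced' (MvPolynomial (Fin 3) k ⧸ Ideal.span {g₃ k})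
  exact (Ideal.isRadical_iff_quotient_reduced _).mpr inferInstance |>.radical

/-! ## The two chart equations meeting the double line are prime -/

/-- The coefficients `y₀²` and `−y₁³` (in `k[y₀, y₁]`) are relatively prime: a divisor of `y₀²` is a unit or a multiple of the prime `y₀`, which does
not divide `y₁³`. [folklore] -/
theorem isRelPrime_coeff : IsRelPrime (X 0 ^ 2 : MvPolynomial (Fin 2) k) (-(X 1 ^ 3)) := by
  intro d hd1 hd2
  have hp : Prime (X 0 : MvPolynomial (Fin 2) k) := X_prime
  obtain ⟨i, hi, hassoc⟩ := (dvd_prime_pow hp 2).mp hd1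
  rcases Nat.eq_zero_or_pos i with rfl | hi0
  · rw [pow_zero] at hassoc
    exact hassoc.symm.isUnit isUnit_one
  · exfalso
    have hX0d : (X 0 : MvPolynomial (Fin 2) k) ∣ d := (dvd_pow_self (X 0) hi0.ne').trans hassoc.symm.dvd
    have h : (X 0 : MvPolynomial (Fin 2) k) ∣ X 1 ^ 3 := (hX0d.trans hd2).trans (neg_dvd.mpr dvd_rfl)
    exact absurd (X_dvd_X.mp (hp.dvd_of_dvd_pow h)) (by decide)

/-- **`g₁ = y₀y₁² − y₂³` is prime** (degree one in `y₀`: `C(y₀²)·Y + C(−y₁³)` over `k[y₁, y₂]` after `finSuccEquiv`, relatively prime coefficients,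
Mathlib `Polynomial.irreducible_C_mul_X_add_C`). [folklore] -/
theorem prime_g₁ : Prime (g₁ k) := by
  have hfin : finSuccEquiv k 2 (g₁ k) = Polynomial.C (X 0 ^ 2) * Polynomial.X + Polynomial.C (-(X 1 ^ 3)) := by
    have h1 : finSuccEquiv k 2 (X 1) = Polynomial.C (X 0) := finSuccEquiv_X_succ (j := 0)
    have h2 : finSuccEquiv k 2 (X 2) = Polynomial.C (X 1) := finSuccEquiv_X_succ (j := 1)
    simp only [g₁, map_sub, map_mul, map_pow, finSuccEquiv_X_zero, h1, h2, map_neg]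
    ring
  have hirr : Irreducible (g₁ k) := by
    rw [← MulEquiv.irreducible_iff (finSuccEquiv k 2), hfin]
    exact Polynomial.irreducible_C_mul_X_add_C (pow_ne_zero 2 (X_ne_zero 0)) (isRelPrime_coeff k)
  exact UniqueFactorizationMonoid.irreducible_iff_prime.mp hirr

/-- The monic quadratic `Y² − C(y₁³)` over `k[y₀, y₁]` is irreducible: a factorisation would give `c² = y₁³`, impossible by degrees.
(Pattern: `Literature.….U30L4g.irreducible_quadratic`.) [folklore] -/
theorem irreducible_quadratic :
    Irreducible (Polynomial.X ^ 2 - Polynomial.C (X 1 ^ 3 : MvPolynomial (Fin 2) k)) := by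
  have hm : (Polynomial.X ^ 2 - Polynomial.C (X 1 ^ 3 : MvPolynomial (Fin 2) k)).Monic := Polynomial.monic_X_pow_sub_C _ two_ne_zero
  have hnd : (Polynomial.X ^ 2 - Polynomial.C (X 1 ^ 3 : MvPolynomial (Fin 2) k)).natDegree = 2 := Polynomial.natDegree_X_pow_sub_C
  by_contra h
  rw [hm.not_irreducible_iff_exists_add_mul_eq_coeff hnd] at h
  obtain ⟨c₁, c₂, h0, h1⟩ := h
  rw [Polynomial.coeff_sub, Polynomial.coeff_X_pow, Polynomial.coeff_C] at h0 h1
  norm_num at h0 h1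
  have hc2 : c₂ = -c₁ := eq_neg_of_add_eq_zero_right h1.symm
  rw [hc2, mul_neg, neg_inj] at h0
  have hsq : c₁ * c₁ = (X 1 : MvPolynomial (Fin 2) k) ^ 3 := h0.symm
  have hdeg := congrArg MvPolynomial.totalDegree hsq
  rcases eq_or_ne c₁ 0 with rfl | hc
  · rw [zero_mul] at hsq
    exact absurd hsq.symm (pow_ne_zero 3 (X_ne_zero (1 : Fin 2)))
  · rw [totalDegree_mul_of_isDomain hc hc, totalDegree_X_pow] at hdeg
    omega

/-- **`g₀ = y₁² − y₂³` is prime** (after `y₀ ↔ y₁` it is the irreducible monic quadratic `Y² − C(z₁³)` over `k[z₀, z₁]`). [folklore] -/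
theorem prime_g₀ : Prime (g₀ k) := by
  have hfin : finSuccEquiv k 2 (rename (Equiv.swap (0 : Fin 3) 1) (g₀ k)) =
      Polynomial.X ^ 2 - Polynomial.C (X 1 ^ 3) := by
    have h2 : finSuccEquiv k 2 (X 2) = Polynomial.C (X 1) := finSuccEquiv_X_succ (j := 1)
    simp only [g₀, map_sub, map_pow, rename_X, Equiv.swap_apply_right,
      Equiv.swap_apply_of_ne_of_ne (show (2 : Fin 3) ≠ 0 by decide) (show (2 : Fin 3) ≠ 1 by decide),
      finSuccEquiv_X_zero, h2]
  have hirr : Irreducible (rename (Equiv.swap (0 : Fin 3) 1) (g₀ k)) := by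
    rw [← MulEquiv.irreducible_iff (finSuccEquiv k 2), hfin]
    exact irreducible_quadratic k
  have hirr' : Irreducible (g₀ k) :=
    (MulEquiv.irreducible_iff (renameEquiv k (Equiv.swap (0 : Fin 3) 1)).toMulEquiv (x := g₀ k)).mp hirr
  exact UniqueFactorizationMonoid.irreducible_iff_prime.mp hirr'

/-- `(g₁)` is a radical ideal. [folklore] -/
theorem radical_span_g₁ : (Ideal.span {g₁ k}).radical = Ideal.span {g₁ k} :=
  ((Ideal.span_singleton_prime (prime_g₁ k).ne_zero).mpr (prime_g₁ k)).radical

/-- `(g₀)` is a radical ideal. [folklore] -/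
theorem radical_span_g₀ : (Ideal.span {g₀ k}).radical = Ideal.span {g₀ k} :=
  ((Ideal.span_singleton_prime (prime_g₀ k).ne_zero).mpr (prime_g₀ k)).radical

end CuspCone

end Summit.ResolutionOfSingularities.ResolutionOfSingularities.Cruxes.EquisingularLiftNat.Sections

end
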